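import Summits.CriticalPhenomena.SAWScalingLimit.Theorems.SAWLoopFugacityFlowAvoidanceLimitGermHub
import Summits.CriticalPhenomena.SAWScalingLimit.Theorems.SAWLoopFugacityFlowAvoidanceLimitThreeScaleArcs
import HarnessLib

/-!
# The two-sided hub, with a free ring parameter

Sub-problem `CriticalPhenomena/SAWScalingLimit`, crux `AvoidanceLimit`, line `symplectic-fermion-anchor` (lead c7), stub
`stub_germTwoSided`. `germHub_of_threeScale` (…GermHub.lean) produces the two-sided hub in the ring `Λ s ≤ |δz−b|∞ ≤ s'/Λ` for ONE
universal `Λ`; the wall stage needs the hub arbitrarily deep in the ring relative to its Whitney scale (walls live in `B(δz, R·d(z))`,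
`d(z) ≤ 2|δz−b|∞`, which must miss the outer gate), i.e. the same statement for EVERY `Λ' ≥ Λ` under the scale separation
`Λ'³ s ≤ s'`. The proof is that of `germHub_of_threeScale` verbatim with the intermediate square at radius `t = 2 Λ' s`
(ring_twoSided's threshold `Λ₀ ≤ Λ ≤ Λ'` is still met) — reprove by copying and generalising that proof, discharging its
hypothesis `h3` by the landed `threeScale_germArcs`. [cite: Chelkak2016, Lemma 3.4]
-/

noncomputable section

open scoped BigOperators Classical Topology
open Set Metric Filter
open Literature.Topology.PlaneTopology
open Literature.Probability.LatticeModels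
open Literature.Probability.RandomPlanarGeometry (JordanDomain)

namespace Summit.CriticalPhenomena.SAWScalingLimit.Theorems.AvoidanceLimit.Anchor

/-- **Two-sided hub with a free ring parameter.** See the module docstring. [cite: Chelkak2016, Lemma 3.4] -/
theorem germHub_ge :
    ∃ Λ : ℝ, 1 < Λ ∧ ∀ (Λ' : ℝ), Λ ≤ Λ' → ∀ (D : JordanDomain), ∀ b ∈ frontier D.carrier,
      ∀ (s s' : ℝ) (hs : 0 < s) (hs' : 0 < s'), Λ' ^ 3 * s ≤ s' →
    ∀ (g o : ℂ), TwoOff D (boxJD b hs) → TwoOff D (boxJD b hs') →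
      g ∈ D.carrier ∩ Literature.Topology.PlaneTopology.box b s → o ∈ D.carrier → o ∉ closedBox b s' →
    ∀ (σ' θ₁ θ₂ τ' : ℝ), σ' < θ₁ → θ₁ < θ₂ → θ₂ < τ' → τ' < σ' + 1 →
      frontier (germRegion D b hs' g o) =
        gateArc D (boxJD b hs') (germGateParam D b hs' g o) ∪ D.boundary '' Set.Icc σ' τ' →
      frontier (germRegion D b hs g o) =
        gateArc D (boxJD b hs) (germGateParam D b hs g o) ∪ D.boundary '' Set.Icc θ₁ θ₂ →
      ({D.boundary θ₁, D.boundary θ₂} : Set ℂ) =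
        {(boxJD b hs).boundary (gateLo D (boxJD b hs) (germGateParam D b hs g o)),
         (boxJD b hs).boundary (gateHi D (boxJD b hs) (germGateParam D b hs g o))} →
      ({D.boundary σ', D.boundary τ'} : Set ℂ) =
        {(boxJD b hs').boundary (gateLo D (boxJD b hs') (germGateParam D b hs' g o)),
         (boxJD b hs').boundary (gateHi D (boxJD b hs') (germGateParam D b hs' g o))} →
    ∃ ρ : ℝ, 0 < ρ ∧ ∀ᶠ δ in 𝓝[>] (0 : ℝ), ∃ z ∈ germSites D b hs' g o δ, z ∉ germSites D b hs g o δ ∧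
      Λ' * s ≤ max |(meshPoint δ z).re - b.re| |(meshPoint δ z).im - b.im| ∧
      Λ' * max |(meshPoint δ z).re - b.re| |(meshPoint δ z).im - b.im| ≤ s' ∧
      ρ ≤ Metric.infDist (meshPoint δ z) (frontier D.carrier) ∧
      1 / 10 ≤ killedPotential (discreteDomainGraph D.carrier δ) (germSites D b hs' g o δ)
        (sideSrc (discreteDomainGraph D.carrier δ) D.carrier δ (D.boundary '' Set.Icc σ' θ₁)) z ∧
      1 / 10 ≤ killedPotential (discreteDomainGraph D.carrier δ) (germSites D b hs' g o δ)
        (sideSrc (discreteDomainGraph D.carrier δ) D.carrier δ (D.boundary '' Set.Icc θ₂ τ')) z := by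
  -- (0) the constants: `Λ₀` of the ring estimate at tolerance `1/2`, `Λ = Λ₀ + 2`; below, `Λ` denotes
  -- the free parameter `Λ' ≥ Λ₀ + 2` of the statement
  obtain ⟨Λ₀, hΛ₀, hR⟩ := ring_twoSided (1 / 2) (by norm_num)
  refine ⟨Λ₀ + 2, by linarith, ?_⟩
  intro Λ hΛΛ D b hb s s' hs hs' hΛ g o h2 h2' hg ho hoc σ' θ₁ θ₂ τ' hσθ hθθ hθτ hτσ hfU' hfU hends hends'
  have hΛ3 : (3 : ℝ) < Λ := by linarith
  have hΛpos : (0 : ℝ) < Λ := by linarith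
  have hΛ₀Λ : Λ₀ ≤ Λ := by linarith
  have hΛcube : 2 * Λ < Λ ^ 3 := by
    have h9 : (9 : ℝ) < Λ ^ 2 := by nlinarith
    nlinarith
  -- the intermediate scale `t = 2 Λ s`
  obtain ⟨t, ht_def⟩ : ∃ t : ℝ, t = 2 * Λ * s := ⟨_, rfl⟩
  have ht : 0 < t := by rw [ht_def]; positivity
  have hst : s < t := by rw [ht_def]; nlinarith
  have hts' : t < s' := by
    rw [ht_def]
    have : 2 * Λ * s < Λ ^ 3 * s := by nlinarith
    linarith
  have hss' : s < s' := hst.trans hts'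
  have hg' : g ∈ D.carrier ∩ Literature.Topology.PlaneTopology.box b s' :=
    ⟨hg.1, Literature.Topology.PlaneTopology.box_mono hss'.le hg.2⟩
  have hgt : g ∈ D.carrier ∩ Literature.Topology.PlaneTopology.box b t :=
    ⟨hg.1, Literature.Topology.PlaneTopology.box_mono hst.le hg.2⟩
  have hoct : o ∉ closedBox b t := fun h => hoc (closedBox_mono hts'.le h)
  -- (1) two points of the `t`-square off `D`: a gate end of the outer gate is a point of `∂D` off the
  -- closed `t`-box
  have hpar' := (germGateParam_spec h2' hg' ho hoc).1
  have h2t : TwoOff D (boxJD b ht) := by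
    refine twoOff_boxJD D ht hb fun hsub => ?_
    have hP := boundary_gateLo_mem_frontier h2' hpar'
    exact (boundary_boxJD_mem b hs' _).2 (closedBox_subset_box hts' (hsub hP))
  -- (2) the intermediate boundary arcs (`threeScale_germArcs`)
  obtain ⟨φ₁, φ₂, hσφ₁, hφ₁θ₁, hθ₂φ₂, hφ₂τ', -, hendst⟩ :=
    threeScale_germArcs D b s t s' hs ht hs' hst hts' g o h2 h2t h2' hg ho hoc σ' θ₁ θ₂ τ' hσθ hθθ hθτ
      hτσ hfU' hfU hends hends'
  -- (3) the endpoint estimates near the two ends of the intermediate gate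
  have hστ' : σ' < τ' := by linarith
  obtain ⟨ρT, hρT, hT⟩ := lateral_oneSided (1 / 10) (by norm_num) D b s' hs' g o h2' hg' ho hoc σ' τ'
    hστ' hτσ hfU' hends' σ' θ₁ φ₁ le_rfl (by linarith) hσφ₁ hφ₁θ₁
  obtain ⟨ρB, hρB, hB⟩ := lateral_oneSided (1 / 10) (by norm_num) D b s' hs' g o h2' hg' ho hoc σ' τ'
    hστ' hτσ hfU' hends' θ₂ τ' φ₂ (by linarith) le_rfl hθ₂φ₂ hφ₂τ'
  -- (4) the transversal: a compact sub-arc of the intermediate gate near its two ends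
  have hpt : germGateParam D b ht g o ∈ gateParams D (boxJD b ht) := (germGateParam_spec h2t hgt ho hoct).1
  have hlohi : gateLo D (boxJD b ht) (germGateParam D b ht g o) <
      gateHi D (boxJD b ht) (germGateParam D b ht g o) := (gateLo_lt h2t hpt).trans (lt_gateHi h2t hpt)
  obtain ⟨γ, hγc, hγS, hγ0, hγ1⟩ :=
    exists_curve_near_ends (boxJD b ht).continuous_boundary hlohi hendst (half_pos hρT) (half_pos hρB)
  have hγgate : ∀ θ ∈ Icc (0 : ℝ) 1, γ θ ∈ germGate D b ht g o := hγS
  set K : Set ℂ := γ '' Icc 0 1 with hK_def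
  have hK : IsCompact K := isCompact_Icc.image hγc
  have hKgate : K ⊆ germGate D b ht g o := by
    rintro _ ⟨θ, hθ, rfl⟩; exact hγgate θ hθ
  have hKD : K ⊆ D.carrier := fun p hp => gate_subset_carrier _ (hKgate hp)
  have hKU' : K ⊆ germRegion D b hs' g o :=
    hKgate.trans (germGate_subset_germRegion ht hs' hts' h2t h2' hgt ho hoc)
  have hKcl : K ⊆ (closure (germRegion D b hs g o))ᶜ := fun p hp =>
    not_mem_closure_germRegion_of_mem_gateArc hs ht hst h2 h2t hg ho hoct
      (gate_subset_gateArc _ (hKgate hp))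
  have hKsq : K ⊆ closedBox b t \ Literature.Topology.PlaneTopology.box b t := by
    rintro _ ⟨θ, hθ, rfl⟩
    obtain ⟨u, -, hu⟩ := hγS θ hθ
    rw [← hu]
    exact boundary_boxJD_mem b ht u
  -- (5) uniform margins of the sub-arc: inside `D`, inside `U'`, off `closure U(s)`
  obtain ⟨r₁, hr₁, hm₁⟩ := exists_margin hK D.isOpen hKD
  obtain ⟨r₂, hr₂, hm₂⟩ := exists_margin hK (isOpen_germRegion h2' hg' ho hoc) hKU'
  obtain ⟨r₃, hr₃, hm₃⟩ := exists_margin hK isClosed_closure.isOpen_compl hKcl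
  -- the tolerance of the lattice walk
  obtain ⟨ε, hε, hε₁, hε₂, hε₃, hε₄, hε₅, hε₆⟩ : ∃ ε : ℝ, 0 < ε ∧ ε ≤ r₁ / 2 ∧ ε ≤ r₂ ∧ ε ≤ r₃ ∧
      ε ≤ Λ * s / 2 ∧ ε ≤ ρT / 2 ∧ ε ≤ ρB / 2 := by
    have hΛs : 0 < Λ * s / 2 := by positivity
    refine ⟨min (min (min (r₁ / 2) r₂) (min r₃ (Λ * s / 2))) (min (ρT / 2) (ρB / 2)),
      lt_min (lt_min (lt_min (half_pos hr₁) hr₂) (lt_min hr₃ hΛs)) (lt_min (half_pos hρT) (half_pos hρB)),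
      ?_, ?_, ?_, ?_, ?_, ?_⟩
    · exact (min_le_left _ _).trans ((min_le_left _ _).trans (min_le_left _ _))
    · exact (min_le_left _ _).trans ((min_le_left _ _).trans (min_le_right _ _))
    · exact (min_le_left _ _).trans ((min_le_right _ _).trans (min_le_left _ _))
    · exact (min_le_left _ _).trans ((min_le_right _ _).trans (min_le_right _ _))
    · exact (min_le_right _ _).trans (min_le_left _ _)
    · exact (min_le_right _ _).trans (min_le_right _ _)
  have hW := exists_walk_near_curve D γ hγc.continuousOn (fun θ hθ => hKD ⟨θ, hθ, rfl⟩) ε hε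
  have hRδ := hR D b hb s s' hs hs' hss' g o h2 h2' hg ho hoc σ' θ₁ θ₂ τ' hσθ hθθ hθτ hτσ hfU' hfU hends
  -- (6) the hub, eventually in `δ`
  refine ⟨r₁ / 2, half_pos hr₁, ?_⟩
  filter_upwards [hRδ, hT, hB, hW] with δ hRδ hTδ hBδ hWδ
  obtain ⟨u, v, π, hu, hv, hsupp⟩ := hWδ
  -- every site of the walk is admissible
  have hsite : ∀ z ∈ π.support, z ∈ germSites D b hs' g o δ ∧ z ∉ germSites D b hs g o δ ∧
      t - ε ≤ max |(meshPoint δ z).re - b.re| |(meshPoint δ z).im - b.im| ∧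
      max |(meshPoint δ z).re - b.re| |(meshPoint δ z).im - b.im| ≤ t + ε ∧
      r₁ / 2 ≤ infDist (meshPoint δ z) (frontier D.carrier) := by
    intro z hz
    obtain ⟨hzm, θ, hθ, hdz⟩ := hsupp z hz
    have hpK : γ θ ∈ K := ⟨θ, hθ, rfl⟩
    have hring := sup_norm_near_square (hKsq hpK) hdz
    refine ⟨⟨hzm, hm₂ _ hpK _ (hdz.trans_le hε₂)⟩,
      fun hzs => hm₃ _ hpK _ (hdz.trans_le hε₃) (subset_closure hzs.2), hring.1, hring.2,
      le_infDist_frontier_of_margin ⟨b, hb⟩ D.isOpen hm₁ hpK (hdz.trans_le hε₁)⟩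
  -- the two side potentials along the walk
  have h0T : ∀ y ∈ germSites D b hs' g o δ, 0 ≤ sideSrc (discreteDomainGraph D.carrier δ) D.carrier δ
      (D.boundary '' Set.Icc σ' θ₁) y := fun _ _ => sideSrc_nonneg
  have h0B : ∀ y ∈ germSites D b hs' g o δ, 0 ≤ sideSrc (discreteDomainGraph D.carrier δ) D.carrier δ
      (D.boundary '' Set.Icc θ₂ τ') y := fun _ _ => sideSrc_nonneg
  have hstart := hTδ u (hsite u π.start_mem_support).1 (by
    calc dist (meshPoint δ u) (D.boundary φ₁)
        ≤ dist (meshPoint δ u) (γ 0) + dist (γ 0) (D.boundary φ₁) := dist_triangle _ _ _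
      _ < ε + ρT / 2 := add_lt_add hu hγ0
      _ ≤ ρT := by linarith)
  have hend := hBδ v (hsite v π.end_mem_support).1 (by
    calc dist (meshPoint δ v) (D.boundary φ₂)
        ≤ dist (meshPoint δ v) (γ 1) + dist (γ 1) (D.boundary φ₂) := dist_triangle _ _ _
      _ < ε + ρB / 2 := add_lt_add hv hγ1
      _ ≤ ρB := by linarith)
  -- ring arithmetic
  have hringΛ : ∀ R : ℝ, t - ε ≤ R → R ≤ t + ε → Λ * s ≤ R ∧ Λ * R ≤ s' := by
    intro R hlo hhi
    have hΛs : 0 < Λ * s := by positivity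
    refine ⟨by linarith, ?_⟩
    have hR' : R ≤ 5 / 2 * (Λ * s) := by linarith
    have h1 : Λ * R ≤ Λ * (5 / 2 * (Λ * s)) := mul_le_mul_of_nonneg_left hR' hΛpos.le
    have h2 : Λ * (5 / 2 * (Λ * s)) ≤ Λ ^ 3 * s := by nlinarith [mul_pos (mul_pos hΛpos hΛpos) hs]
    linarith
  have hsum : ∀ z ∈ π.support, (1 : ℝ) / 2 ≤
      killedPotential (discreteDomainGraph D.carrier δ) (germSites D b hs' g o δ)
          (sideSrc (discreteDomainGraph D.carrier δ) D.carrier δ (D.boundary '' Set.Icc σ' θ₁)) z +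
        killedPotential (discreteDomainGraph D.carrier δ) (germSites D b hs' g o δ)
          (sideSrc (discreteDomainGraph D.carrier δ) D.carrier δ (D.boundary '' Set.Icc θ₂ τ')) z := by
    intro z hz
    obtain ⟨hzΘ', hzΘ, hlo, hhi, -⟩ := hsite z hz
    obtain ⟨hΛsR, hΛRs'⟩ := hringΛ _ hlo hhi
    have hR0 : 0 ≤ max |(meshPoint δ z).re - b.re| |(meshPoint δ z).im - b.im| :=
      (abs_nonneg _).trans (le_max_left _ _)
    have h := hRδ z hzΘ' hzΘ ((mul_le_mul_of_nonneg_right hΛ₀Λ hs.le).trans hΛsR)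
      ((mul_le_mul_of_nonneg_right hΛ₀Λ hR0).trans hΛRs')
    linarith
  obtain ⟨z, hz, hzT, hzB⟩ := exists_hub_vertex_zd (discreteDomainGraph D.carrier δ)
    (germSites D b hs' g o δ) _ _ (1 / 2)
    ((discreteDomainGraph_le_meshGraph _ _).trans (meshGraph_le_zdGraph _ _)) (by norm_num)
    (fun z => killedPotential_nonneg h0T z) (fun z => killedPotential_nonneg h0B z)
    (killedPotential_superharmonicOn h0T) (killedPotential_superharmonicOn h0B) π
    (fun z hz => (hsite z hz).1) (by linarith) (by linarith) hsum
  obtain ⟨hzΘ', hzΘ, hlo, hhi, hρ⟩ := hsite z hz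
  obtain ⟨hΛsR, hΛRs'⟩ := hringΛ _ hlo hhi
  exact ⟨z, hzΘ', hzΘ, hΛsR, hΛRs', hρ, by linarith, by linarith⟩

end Summit.CriticalPhenomena.SAWScalingLimit.Theorems.AvoidanceLimit.Anchor

end
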